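import Summits.RiemannHypothesis.RiemannHypothesis.Theorems.TiltedLandingLaw421R3SuccResidual

/-! # TiltedLandingLaw421 — round 3q SUPPORT: `NegatedWindowResidual` = dimple lemma + ANTI-ESCAPE (W-08, C1 rh-idea-5 g25, image v4 over the hand's landed residual; v4 = v3 + the WINDOW-GENERIC form for C3 g36's sign-box step)

SUPPORT module (proves no stub, no crux; no `sorry`): splits the landed OPEN residual `RhW08.SuccB.NegatedWindowResidual` (`…R3SuccResidual`, sw-alpha g16;
`restSuccBotQ_of_residual`) into C3's dimple lemma (`DimpleSig`, landing as `…R3Dimple`, `RhIdea3.G35.Landing.readyR2_of_dimple_state`) and the narrower OPEN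
residual `AntiEscape` (no all-in-band in-range window AND no dimple ⇒ the successor level is inhabited): ★ `negatedWindowResidual_of_split : DimpleSig → AntiEscape →
NegatedWindowResidual`, ★★ `restSuccBotQ_of_pieces : DimpleSig → AntiEscape → RestSuccBotQ`; and the WINDOW-GENERIC form (any window predicate `W` with a
no-successor Ready′ lemma `WindowCaseSig W` may replace `AllInBandInRangeWindow` — e.g. C3 g36's sign-box window, which admits MIXED boxes and so SHRINKS the residual):
`AntiEscapeG W`, ★★ `restSuccBotQ_of_piecesG : WindowCaseSig W → DimpleSig → AntiEscapeG W → RestSuccBotQ`, `windowCaseSig_allInBand`, `antiEscapeG_allInBand_iff`. GLOBAL forms only. Nothing here bears on the truth of RH. -/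

namespace RhW08.SuccSplit

open Complex Set
open RhIdea6.G17.W07C7 RhIdea6.G17.W07C7.Rev6 RhIdea6.G18.W07C8.Law421BirthS RhIdea6.G19.W07C11.Seam RhW07.C12.FieldSplit
open RhW08.StSwap RhW08.QuadW RhW08.SealSwapQ RhW08.SuccB

/-- The DIMPLE LEMMA as a signature (C3 `readyR2_of_dimple_state`). -/
def DimpleSig : Prop :=
  ∀ (η : ℝ) (f : ℂ → ℂ) (x₀ s hmax R Hs : ℝ) (B : ℕ), EngineHyps5 2 η f x₀ s hmax R Hs B → ∀ (k : ℕ) (u v : ℂ),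
    StTrkDQ η f x₀ s hmax R Hs B k v →
    (∀ x ∈ Icc (v.re - v.im) (v.re + v.im), iteratedDeriv k f (x : ℂ) ≠ 0) →
    (iteratedDeriv (k + 1) f ((v.re - v.im : ℝ) : ℂ)).re * (iteratedDeriv k f ((v.re - v.im : ℝ) : ℂ)).re < 0 →
    0 < (iteratedDeriv (k + 1) f ((v.re + v.im : ℝ) : ℂ)).re * (iteratedDeriv k f ((v.re + v.im : ℝ) : ℂ)).re →
    ReadyR2 η f x₀ s hmax R Hs B k u

/-- The weak-field DIMPLE configuration at a level-`k` pair `v`: tooth-free shadow and inward signs of `f^{(k+1)}·f^{(k)}` at both shadow ends. -/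
def Dimple (f : ℂ → ℂ) (k : ℕ) (v : ℂ) : Prop :=
  (∀ x ∈ Icc (v.re - v.im) (v.re + v.im), iteratedDeriv k f (x : ℂ) ≠ 0) ∧
    (iteratedDeriv (k + 1) f ((v.re - v.im : ℝ) : ℂ)).re * (iteratedDeriv k f ((v.re - v.im : ℝ) : ℂ)).re < 0 ∧
    0 < (iteratedDeriv (k + 1) f ((v.re + v.im : ℝ) : ℂ)).re * (iteratedDeriv k f ((v.re + v.im : ℝ) : ℂ)).re

/-- ANTI-ESCAPE (OPEN): lowest band state of a non-Ready′ level, no all-in-band in-range window, not a dimple ⇒ a level-`(j+1)` band state. -/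
def AntiEscape : Prop :=
  ∀ (η : ℝ) (f : ℂ → ℂ) (x₀ s hmax R Hs : ℝ) (B : ℕ), EngineHyps5 2 η f x₀ s hmax R Hs B → ∀ (j : ℕ) (v : ℂ),
    IsLowest StTrkDQ η f x₀ s hmax R Hs B j v → ¬ ReadyR2 η f x₀ s hmax R Hs B j v →
    ¬ AllInBandInRangeWindow f x₀ R Hs j v → ¬ Dimple f j v →
    ∃ u : ℂ, StTrkDQ η f x₀ s hmax R Hs B (j + 1) u

/-- ★ the landed residual ⟸ the dimple lemma + ANTI-ESCAPE. -/
theorem negatedWindowResidual_of_split (hD : DimpleSig) (hA : AntiEscape) : NegatedWindowResidual := by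
  intro η f x₀ s hmax R Hs B hE j v hlow hnr hempty hwin
  by_cases hdim : Dimple f j v
  · exact hnr (hD η f x₀ s hmax R Hs B hE j v v hlow.1 hdim.1 hdim.2.1 hdim.2.2)
  · obtain ⟨u, hu⟩ := hA η f x₀ s hmax R Hs B hE j v hlow hnr hwin hdim
    exact hempty u hu

/-- ★★ STUB 1 in two named pieces over the landed residual. -/
theorem restSuccBotQ_of_pieces (hD : DimpleSig) (hA : AntiEscape) : RestSuccBotQ :=
  restSuccBotQ_of_residual (negatedWindowResidual_of_split hD hA)

/-! ## Window-generic form (for a weaker window predicate, e.g. a SIGN-box step admitting mixed boxes) -/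

/-- A no-successor Ready′ lemma for a window predicate `W f x₀ R Hs j v` (the shape of `readyR2_of_window_noSucc`). -/
def WindowCaseSig (W : (ℂ → ℂ) → ℝ → ℝ → ℝ → ℕ → ℂ → Prop) : Prop :=
  ∀ (η : ℝ) (f : ℂ → ℂ) (x₀ s hmax R Hs : ℝ) (B : ℕ), EngineHyps5 2 η f x₀ s hmax R Hs B → ∀ (j : ℕ) (v : ℂ),
    StTrkDQ η f x₀ s hmax R Hs B j v → (∀ u' : ℂ, ¬ StTrkDQ η f x₀ s hmax R Hs B (j + 1) u') →
    W f x₀ R Hs j v → ReadyR2 η f x₀ s hmax R Hs B j v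

/-- ANTI-ESCAPE relative to the window predicate `W` (OPEN for each `W`; the weaker `W`, the smaller this residual). -/
def AntiEscapeG (W : (ℂ → ℂ) → ℝ → ℝ → ℝ → ℕ → ℂ → Prop) : Prop :=
  ∀ (η : ℝ) (f : ℂ → ℂ) (x₀ s hmax R Hs : ℝ) (B : ℕ), EngineHyps5 2 η f x₀ s hmax R Hs B → ∀ (j : ℕ) (v : ℂ),
    IsLowest StTrkDQ η f x₀ s hmax R Hs B j v → ¬ ReadyR2 η f x₀ s hmax R Hs B j v →
    ¬ W f x₀ R Hs j v → ¬ Dimple f j v →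
    ∃ u : ℂ, StTrkDQ η f x₀ s hmax R Hs B (j + 1) u

/-- ★★ STUB 1 from ANY window-case lemma + the dimple lemma + the matching anti-escape residual. -/
theorem restSuccBotQ_of_piecesG {W : (ℂ → ℂ) → ℝ → ℝ → ℝ → ℕ → ℂ → Prop}
    (hW : WindowCaseSig W) (hD : DimpleSig) (hA : AntiEscapeG W) : RestSuccBotQ := by
  intro η f x₀ s hmax R Hs B hE j hC
  rw [chargedBot_iffQ] at hC
  obtain ⟨v, hlow, hnr, _hno_drop⟩ := hC
  by_contra hS
  have hempty : ∀ u' : ℂ, ¬ StTrkDQ η f x₀ s hmax R Hs B (j + 1) u' := fun u' hu' => hS ⟨u', hu'⟩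
  by_cases hw : W f x₀ R Hs j v
  · exact hnr (hW η f x₀ s hmax R Hs B hE j v hlow.1 hempty hw)
  · by_cases hdim : Dimple f j v
    · exact hnr (hD η f x₀ s hmax R Hs B hE j v v hlow.1 hdim.1 hdim.2.1 hdim.2.2)
    · exact hS (hA η f x₀ s hmax R Hs B hE j v hlow hnr hw hdim)

/-- The landed window case is an instance: `W := AllInBandInRangeWindow` (sw-alpha g16 `readyR2_of_window_noSucc`). -/
theorem windowCaseSig_allInBand : WindowCaseSig AllInBandInRangeWindow :=
  fun _η _f _x₀ _s _hmax _R _Hs _B hE _j _v hv hempty hW => readyR2_of_window_noSucc hE hv hempty hW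

/-- … and `AntiEscape` is its residual. -/
theorem antiEscapeG_allInBand_iff : AntiEscapeG AllInBandInRangeWindow ↔ AntiEscape := Iff.rfl

end RhW08.SuccSplit
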